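import Summits.CriticalPhenomena.PercolationContinuityZ3.Theorems.PercNearOneGluingNoHeavyLowerTailSahiE3JuntaMeet
import Mathlib.Tactic.Linarith
import Mathlib.Tactic.Ring
import HarnessLib

/-!
# `NoHeavyLowerTail` (crux stmt-CriticalPhenomena-4575), Sahi programme P4 (monotone coupling / transport):
# SAHI'S INEQUALITY IS LOCAL IN THE INTERSECTION — `C₃` on the block `W` alone implies `E₃(U,A,B) ≥ 0` in every dimension
# whenever `A ∩ B` depends only on the coordinates `W`

Support file (cell `prim-l12`, seat P4, generation 3; `--supports stmt-CriticalPhenomena-4575`).  No named facts, no sorries,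
no definitions.  Sharpens `…SahiE3JuntaMeet` (`sahiE3_nonneg_of_mul_junta`): its two tangent hypotheses (TanA), (TanB) are NOT
independent conditions — they follow from Sahi's inequality on the block for the very same top-fibre triple, by the exact identity

  `Φ_T(π, b*) = E₃^W(t, f*, g*) + (a* − π)·(E_W[t g*] − b*·E_W t)`      (and symmetrically for `Φ_T(a*, π)`),

whose second term is `≥ 0` by Harris on the block (`t, g*` monotone) and `a* ≥ π`.  (Equivalently: the bilinear top-fibre
functional `Φ_T(x,y)` of `…SahiE3JuntaMeet` is DECREASING in each variable on `[π,a*] × [π,b*]` — its slopes are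
`−(E_W[t g*] − y·E_W t) ≤ 0` and `−(E_W[t f*] − x·E_W t) ≤ 0` — so its minimum is the Sahi corner `(a*,b*)`.)

* `tan_of_block` — (TanA) from (C3W) at the same `t` (monotone `t, g*`; `{0,1}`-valued `f*, g*`) on the weighted cube `W`.
* **`sahiE3_nonneg_of_mul_junta_of_block`** — THE TRANSFER THEOREM: on the weighted cube `W ∪ D` (`W ∩ D = ∅`, `p ∈ [0,1]`),
  if `u, f, g` are monotone `{0,1}`-valued and `f·g` is `W`-determined (`f(Z ∪ T)g(Z ∪ T) = f(D ∪ T)g(D ∪ T)`, `Z ⊆ D`,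
  `T ⊆ W`), and Sahi's inequality holds ON THE BLOCK for the top fibre — `E₃^W(t, f(D ∪ ·), g(D ∪ ·)) ≥ 0` for every monotone
  `{0,1}`-valued `t` — then `E₃(u, f, g) ≥ 0` on `W ∪ D`.
CONSEQUENCES.  (i) Kahn's Conjecture 5 / Sahi's `C₃` on `{0,1}^m` (all weights) implies `C₃` in EVERY dimension for every
up-set triple one of whose pairwise intersections depends on at most `m` coordinates ("`C₃` is local in the intersection");
with the tree's certificate `…SahiC3CubeFour` (`m ≤ 4`) this covers, modulo the `ED`/`prodBernoulli` bridge, every triple with a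
pairwise intersection depending on `≤ 4` coordinates, and `…SahiE3PrincipalMeet` is the case of a principal intersection
(block triple with `A* ∩ B* = {⊤}`).  (ii) A minimal counterexample to Kahn's Conjecture 5 (minimal dimension `k`) has ALL
THREE pairwise intersections of full essential support `k`.  (iii) The limit statement of `…SahiE3JuntaMeetLimit` (tangent
conditions from `C₃` on `|W| + 1` coordinates) is superseded by the same-dimension statement here.  [this work]
-/

noncomputable section

namespace Summit.CriticalPhenomena.PercolationContinuityZ3.Theorems

namespace SahiE3JuntaMeet

open Finset Literature.Probability.Percolation Literature.Probability.Percolation.DecisionTree SahiE3PrincipalMeet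

variable {ι : Type*} [DecidableEq ι]

/-- **The tangent condition follows from Sahi's inequality on the block.**  For monotone `t`, `{0,1}`-valued `fs` and monotone
`{0,1}`-valued `gs` on the
weighted cube `W` (`p ∈ [0,1]`): if `E₃^W(t, fs, gs) ≥ 0` then
`E_W gs · E_W[t fs (1 − gs)] ≤ E₃^W(t, fs·gs, gs)` (hypothesis (TanA) of `sahiE3_nonneg_of_mul_junta`), by the identity
`(TanA-slack) = E₃^W(t,fs,gs) + (E_W fs − E_W[fs gs])·(E_W[t gs] − E_W gs · E_W t)` and Harris. [this work] -/
theorem tan_of_block (W : Finset ι) {p : ι → ℝ} (hp0 : ∀ i, 0 ≤ p i) (hp1 : ∀ i, p i ≤ 1)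
    {t fs gs : Finset ι → ℝ}
    (ht : ∀ ⦃S T : Finset ι⦄, S ⊆ T → t S ≤ t T) (hfs01 : ∀ S, fs S = 0 ∨ fs S = 1)
    (hgs : ∀ ⦃S T : Finset ι⦄, S ⊆ T → gs S ≤ gs T) (hgs01 : ∀ S, gs S = 0 ∨ gs S = 1)
    (hC3 : 0 ≤ 2 * ED W p (fun S => t S * fs S * gs S) + ED W p t * ED W p fs * ED W p gs
          - ED W p t * ED W p (fun S => fs S * gs S) - ED W p fs * ED W p (fun S => t S * gs S)
          - ED W p gs * ED W p (fun S => t S * fs S)) :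
    ED W p gs * ED W p (fun S => t S * fs S * (1 - gs S))
      ≤ 2 * ED W p (fun S => t S * (fs S * gs S) * gs S)
        + ED W p t * ED W p (fun S => fs S * gs S) * ED W p gs
        - ED W p t * ED W p (fun S => (fs S * gs S) * gs S)
        - ED W p (fun S => fs S * gs S) * ED W p (fun S => t S * gs S)
        - ED W p gs * ED W p (fun S => t S * (fs S * gs S)) := by
  have hfs0 : ∀ S, 0 ≤ fs S := fun S => by rcases hfs01 S with h | h <;> norm_num [h]
  have hgs1 : ∀ S, gs S ≤ 1 := fun S => by rcases hgs01 S with h | h <;> norm_num [h]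
  have hidem : ∀ S, fs S * gs S * gs S = fs S * gs S := fun S => by rw [mul_assoc, mul_self_of_01 hgs01]
  -- block quantities
  obtain ⟨X, hX⟩ : ∃ x : ℝ, x = ED W p (fun S => t S * fs S * gs S) := ⟨_, rfl⟩
  obtain ⟨F, hF⟩ : ∃ x : ℝ, x = ED W p (fun S => t S * fs S) := ⟨_, rfl⟩
  obtain ⟨G, hG⟩ : ∃ x : ℝ, x = ED W p (fun S => t S * gs S) := ⟨_, rfl⟩
  obtain ⟨π, hπ⟩ : ∃ x : ℝ, x = ED W p (fun S => fs S * gs S) := ⟨_, rfl⟩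
  obtain ⟨aS, haS⟩ : ∃ x : ℝ, x = ED W p fs := ⟨_, rfl⟩
  obtain ⟨bS, hbS⟩ : ∃ x : ℝ, x = ED W p gs := ⟨_, rfl⟩
  obtain ⟨τ, hτ⟩ : ∃ x : ℝ, x = ED W p t := ⟨_, rfl⟩
  have eA : ED W p (fun S => t S * fs S * (1 - gs S)) = F - X := by
    have h : ED W p (fun S => t S * fs S * (1 - gs S)) + ED W p (fun S => t S * fs S * gs S)
        = ED W p (fun S => t S * fs S) := by
      rw [← ED_add]; exact ED_congr_sub W p fun S _ => by ring
    rw [hF, hX]; linarith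
  have eB : ED W p (fun S => t S * (fs S * gs S) * gs S) = X := by
    rw [hX]; exact ED_congr_sub W p fun S _ => by rw [mul_assoc (t S) (fs S * gs S) (gs S), hidem S, ← mul_assoc]
  have eC : ED W p (fun S => (fs S * gs S) * gs S) = π := by
    rw [hπ]; exact ED_congr_sub W p fun S _ => hidem S
  have eD : ED W p (fun S => t S * (fs S * gs S)) = X := by
    rw [hX]; exact ED_congr_sub W p fun S _ => by rw [← mul_assoc]
  rw [eA, eB, eC, eD, ← hτ, ← hπ, ← hG, ← hbS]
  rw [← hX, ← hτ, ← haS, ← hbS, ← hπ, ← hG, ← hF] at hC3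
  -- Harris on the block and `π ≤ a*`
  have hH : τ * bS ≤ G := by
    rw [hτ, hbS, hG]; exact ED_mul_ED_le_ED_mul W hp0 hp1 ht hgs
  have hπa : π ≤ aS := by
    rw [hπ, haS]
    exact ED_mono W hp0 hp1 fun S _ => (mul_le_mul_of_nonneg_left (hgs1 S) (hfs0 S)).trans_eq (mul_one _)
  have hprod : 0 ≤ (aS - π) * (G - τ * bS) := mul_nonneg (sub_nonneg.2 hπa) (sub_nonneg.2 hH)
  nlinarith [hC3, hprod]

/-- **Sahi's inequality is local in the intersection (the transfer theorem).**  On the weighted cube on `W ∪ D` (`W ∩ D = ∅`,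
`p ∈ [0,1]`), let `u, f, g` be monotone `{0,1}`-valued with `f(Z ∪ T)·g(Z ∪ T) = f(D ∪ T)·g(D ∪ T)` for `Z ⊆ D`, `T ⊆ W` (the
intersection of the two events is determined by the block `W`).  If Sahi's inequality holds ON THE BLOCK for the top fibre,
`E₃^W(t, f(D ∪ ·), g(D ∪ ·)) ≥ 0` for every monotone `{0,1}`-valued `t`, then `E₃(u, f, g) ≥ 0` on `W ∪ D`.  Hence Kahn's
Conjecture 5 on `{0,1}^m` implies it, in every dimension, for all triples with an `m`-junta pairwise intersection.
[this work; `sahiE3_nonneg_of_mul_junta` + `tan_of_block`] -/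
theorem sahiE3_nonneg_of_mul_junta_of_block (W D : Finset ι) (hWD : Disjoint W D) {p : ι → ℝ}
    (hp0 : ∀ i, 0 ≤ p i) (hp1 : ∀ i, p i ≤ 1) {u f g : Finset ι → ℝ}
    (hu : ∀ ⦃S T : Finset ι⦄, S ⊆ T → u S ≤ u T) (hu01 : ∀ S, u S = 0 ∨ u S = 1)
    (hf : ∀ ⦃S T : Finset ι⦄, S ⊆ T → f S ≤ f T) (hf01 : ∀ S, f S = 0 ∨ f S = 1)
    (hg : ∀ ⦃S T : Finset ι⦄, S ⊆ T → g S ≤ g T) (hg01 : ∀ S, g S = 0 ∨ g S = 1)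
    (hfg : ∀ Z, Z ⊆ D → ∀ T, T ⊆ W → f (Z ∪ T) * g (Z ∪ T) = f (D ∪ T) * g (D ∪ T))
    (hC3 : ∀ t : Finset ι → ℝ, (∀ ⦃S T : Finset ι⦄, S ⊆ T → t S ≤ t T) → (∀ S, t S = 0 ∨ t S = 1) →
      0 ≤ 2 * ED W p (fun S => t S * f (D ∪ S) * g (D ∪ S))
          + ED W p t * ED W p (fun S => f (D ∪ S)) * ED W p (fun S => g (D ∪ S))
          - ED W p t * ED W p (fun S => f (D ∪ S) * g (D ∪ S))
          - ED W p (fun S => f (D ∪ S)) * ED W p (fun S => t S * g (D ∪ S))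
          - ED W p (fun S => g (D ∪ S)) * ED W p (fun S => t S * f (D ∪ S))) :
    0 ≤ 2 * ED (W ∪ D) p (fun S => u S * f S * g S)
          + ED (W ∪ D) p u * ED (W ∪ D) p f * ED (W ∪ D) p g
          - ED (W ∪ D) p u * ED (W ∪ D) p (fun S => f S * g S)
          - ED (W ∪ D) p f * ED (W ∪ D) p (fun S => u S * g S)
          - ED (W ∪ D) p g * ED (W ∪ D) p (fun S => u S * f S) := by
  have hfs : ∀ ⦃S T : Finset ι⦄, S ⊆ T → f (D ∪ S) ≤ f (D ∪ T) :=
    fun S T hST => hf (Finset.union_subset_union (Finset.Subset.refl D) hST)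
  have hgs : ∀ ⦃S T : Finset ι⦄, S ⊆ T → g (D ∪ S) ≤ g (D ∪ T) :=
    fun S T hST => hg (Finset.union_subset_union (Finset.Subset.refl D) hST)
  refine sahiE3_nonneg_of_mul_junta W D hWD hp0 hp1 hu hu01 hf hf01 hg hg01 hfg hC3 ?_ ?_
  · intro t ht ht01
    exact tan_of_block W hp0 hp1 ht (fs := fun S => f (D ∪ S)) (gs := fun S => g (D ∪ S))
      (fun S => hf01 _) hgs (fun S => hg01 _) (hC3 t ht ht01)
  · intro t ht ht01
    -- (TanB) is (TanA) with `f` and `g` exchanged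
    have hC3' : 0 ≤ 2 * ED W p (fun S => t S * g (D ∪ S) * f (D ∪ S))
          + ED W p t * ED W p (fun S => g (D ∪ S)) * ED W p (fun S => f (D ∪ S))
          - ED W p t * ED W p (fun S => g (D ∪ S) * f (D ∪ S))
          - ED W p (fun S => g (D ∪ S)) * ED W p (fun S => t S * f (D ∪ S))
          - ED W p (fun S => f (D ∪ S)) * ED W p (fun S => t S * g (D ∪ S)) := by
      have h := hC3 t ht ht01
      have c1 : ED W p (fun S => t S * g (D ∪ S) * f (D ∪ S)) = ED W p (fun S => t S * f (D ∪ S) * g (D ∪ S)) :=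
        ED_congr_sub W p fun S _ => by ring
      have c2 : ED W p (fun S => g (D ∪ S) * f (D ∪ S)) = ED W p (fun S => f (D ∪ S) * g (D ∪ S)) :=
        ED_congr_sub W p fun S _ => by ring
      rw [c1, c2]
      linarith
    have h := tan_of_block W hp0 hp1 ht (fs := fun S => g (D ∪ S)) (gs := fun S => f (D ∪ S))
      (fun S => hg01 _) hfs (fun S => hf01 _) hC3'
    have c1 : ED W p (fun S => t S * (g (D ∪ S) * f (D ∪ S)) * f (D ∪ S))
        = ED W p (fun S => t S * f (D ∪ S) * (f (D ∪ S) * g (D ∪ S))) := ED_congr_sub W p fun S _ => by ring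
    have c2 : ED W p (fun S => g (D ∪ S) * f (D ∪ S)) = ED W p (fun S => f (D ∪ S) * g (D ∪ S)) :=
      ED_congr_sub W p fun S _ => by ring
    have c3 : ED W p (fun S => g (D ∪ S) * f (D ∪ S) * f (D ∪ S))
        = ED W p (fun S => f (D ∪ S) * (f (D ∪ S) * g (D ∪ S))) := ED_congr_sub W p fun S _ => by ring
    have c4 : ED W p (fun S => t S * (g (D ∪ S) * f (D ∪ S)))
        = ED W p (fun S => t S * (f (D ∪ S) * g (D ∪ S))) := ED_congr_sub W p fun S _ => by ring
    rw [c1, c2, c3, c4] at h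
    linarith

end SahiE3JuntaMeet

end Summit.CriticalPhenomena.PercolationContinuityZ3.Theorems

end
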